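import Literature.Probability.RandomPlanarGeometry.HexSAWRotSurfaceYcGrowth
import HarnessLib

/-!
# Rotated frame: `y_H` is the radius of convergence of the `y`-series `B^{→}_H(x_c; y)`

Topic `Literature/Probability/RandomPlanarGeometry` (continues the rotated capstone `HexSAWRotSurfaceFugacity.lean` — `HV.rotBddSet H`,
`HV.rotYT H := sSup (rotBddSet H)`, the LANE DEFINITION of Beaton's strip threshold in the rotated frame — twin of the
Duminil-Copin–Smirnov-frame file `HexSAWStripSurfaceRadius.lean`).

Beaton's Corollary 10 (arXiv v3 p. 15, for the hatted series `B̂_T`) with Lemma 12 (p. 17: `B_T = (1 + xy) B̂_T`, same radius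
`y_T`) says the series (in `y`) `B_T(x_c, y)` has radius of convergence `y_T`.  With the lane
definition `rotYT H` (a boundedness threshold of `W ↦ B^{→}_{H,W+1}(x_c; y)`), this file proves exactly that reading: write
`B^{→}_{H,W+1}(x_c; y) = Σ_m β^{→}_{H,W,m} y^m` (`HV.rotTopCoeffY`, `HV.hasSum_rotTopCoeffY`), `β^{→}_{H,m} := sup_W β^{→}_{H,W,m}`
(`HV.rotTopCoeff`, monotone in `W`); then for `H ≥ 2`:

* `HV.hasSum_rotTopCoeff_of_mem` — on `rotBddSet H` the series `Σ_m β^{→}_{H,m} y^m` converges, to `sup_W B^{→}_{H,W+1}(x_c; y)`;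
* `HV.not_summable_rotTopCoeff` — off it (`y ≥ 0`) it diverges;
* **`HV.rotBddSet_eq_summable`**, **`HV.rotYT_eq_sSup_summable`** — `y_H = sup {y ≥ 0 : Σ_m β^{→}_{H,m} y^m converges}`, the radius of
  convergence on the nonnegative axis;
* `HV.summable_rotTopCoeff_of_lt_rotYT` / `HV.not_summable_rotTopCoeff_of_rotYT_lt` — the two sides.
-/

noncomputable section

open Finset Filter Topology

namespace Literature.Probability.RandomPlanarGeometry.SAW.HV

variable {H : ℕ} {y : ℝ}

/-! ### The coefficients of `B^{→}_{H,W+1}(x_c; y)` -/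

/-- `β^{→}_{H,W,m} := Σ_{γ right-started top walk of D(H, W+1) ∖ {a⁻}, c(γ) = m} x_c^{|γ|}`, the coefficient of `y^m` in `B^{→}_{H,W+1}(x_c; y)`.
[cite: Beaton2014RotatedHoneycomb, §2.4 (arXiv v3 p. 8: the generating functions with argument y); Corollary 10 (p. 15)] -/
def rotTopCoeffY (H Wd m : ℕ) : ℝ :=
  ∑ P ∈ ((midWalks ((rotStripV H (Wd + 1)).erase wOut)).filter (fun P => IsRotTopDart H (finalDart P))).filter
      (fun P => topContacts H P = m), hexCriticalFugacity ^ mwLen P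

/-- `β^{→}_{H,W,m} ≥ 0`. [cite: Beaton2014RotatedHoneycomb, §2.4 (arXiv v3 p. 8)] -/
theorem rotTopCoeffY_nonneg (H Wd m : ℕ) : 0 ≤ rotTopCoeffY H Wd m :=
  sum_nonneg fun _ _ => pow_nonneg hexCriticalFugacity_pos_lt_one.1.le _

/-- `β^{→}_{H,W,m}` increases with `W`. [cite: Beaton2014RotatedHoneycomb, §4 (arXiv v3 p. 16: "B_{T,L} … increasing with L")] -/
theorem rotTopCoeffY_mono_W {H Wd Wd' : ℕ} (h : Wd ≤ Wd') (m : ℕ) : rotTopCoeffY H Wd m ≤ rotTopCoeffY H Wd' m := by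
  unfold rotTopCoeffY
  refine sum_le_sum_of_subset_of_nonneg (filter_subset_filter _ ?_) fun _ _ _ => pow_nonneg hexCriticalFugacity_pos_lt_one.1.le _
  intro P hP
  simp only [mem_filter] at hP ⊢
  exact ⟨mem_midWalks_iff.2 ((mem_midWalks_iff.1 hP.1).mono (erase_subset_erase _ (rotStripV_mono_width (by omega)))), hP.2⟩

/-- **`B^{→}_{H,W+1}(x_c; y) = Σ_m β^{→}_{H,W,m} y^m`** (a polynomial in `y` with nonnegative coefficients).
[cite: Beaton2014RotatedHoneycomb, §2.4 (arXiv v3 p. 8)] -/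
theorem hasSum_rotTopCoeffY (H Wd : ℕ) (y : ℝ) :
    HasSum (fun m => rotTopCoeffY H Wd m * y ^ m) (rotGFy ((rotStripV H (Wd + 1)).erase wOut) H (IsRotTopDart H) y) := by
  set W := (midWalks ((rotStripV H (Wd + 1)).erase wOut)).filter (fun P => IsRotTopDart H (finalDart P)) with hW
  have h1 : rotGFy ((rotStripV H (Wd + 1)).erase wOut) H (IsRotTopDart H) y =
      ∑ m ∈ W.image (topContacts H), rotTopCoeffY H Wd m * y ^ m := by
    rw [rotGFy, ← hW, ← Finset.sum_fiberwise_of_maps_to (g := topContacts H) (t := W.image (topContacts H))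
      (fun P hP => mem_image_of_mem _ hP)]
    refine sum_congr rfl fun m _ => ?_
    rw [rotTopCoeffY, ← hW, sum_mul]
    refine sum_congr rfl fun P hP => ?_
    rw [(mem_filter.1 hP).2]
  rw [h1]
  refine hasSum_sum_of_ne_finset_zero fun m hm => ?_
  have h0 : rotTopCoeffY H Wd m = 0 := by
    rw [rotTopCoeffY, ← hW]
    exact sum_eq_zero fun P hP => (hm (mem_image.2 ⟨P, (mem_filter.1 hP).1, (mem_filter.1 hP).2⟩)).elim
  rw [h0, zero_mul]

/-- `β^{→}_{H,W,m} ≤ B^{→}_{H,W+1}(x_c; 1)`. [cite: Beaton2014RotatedHoneycomb, §2.4 (arXiv v3 p. 8)] -/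
theorem rotTopCoeffY_le_rotGFy_one (H Wd m : ℕ) :
    rotTopCoeffY H Wd m ≤ rotGFy ((rotStripV H (Wd + 1)).erase wOut) H (IsRotTopDart H) 1 := by
  have h := le_hasSum (hasSum_rotTopCoeffY H Wd 1) m fun j _ => by
    simpa using rotTopCoeffY_nonneg H Wd j
  simpa using h

/-- The coefficients are bounded in `W` (`H ≥ 1`; by the `y = 1 < y†` bound, Lemma 12). [cite: Beaton2014RotatedHoneycomb, §4, Lemma 12 (arXiv v3 p. 17)] -/
theorem bddAbove_rotTopCoeffY (hH : 1 ≤ H) (m : ℕ) : BddAbove (Set.range fun Wd : ℕ => rotTopCoeffY H Wd m) := by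
  obtain ⟨K, hK⟩ := (mem_rotBddSet_of_lt hH one_pos one_lt_rotYdagger).2
  exact ⟨K, by rintro _ ⟨Wd, rfl⟩; exact (rotTopCoeffY_le_rotGFy_one H Wd m).trans (hK ⟨Wd, rfl⟩)⟩

/-! ### The coefficients `β^{→}_{H,m}` of `B^{→}_H(x_c; y)` -/

/-- **`β^{→}_{H,m} := sup_W β^{→}_{H,W,m}`**, the coefficient of `y^m` in `B^{→}_H(x_c; y)`.
[cite: Beaton2014RotatedHoneycomb, Corollary 10 (arXiv v3 p. 15: "The series (in y) … have radius of convergence y_T")] -/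
def rotTopCoeff (H m : ℕ) : ℝ := ⨆ Wd : ℕ, rotTopCoeffY H Wd m

/-- `β^{→}_{H,W,m} → β^{→}_{H,m}` (`H ≥ 1`). [cite: Beaton2014RotatedHoneycomb, Corollary 10 (arXiv v3 p. 15)] -/
theorem tendsto_rotTopCoeffY (hH : 1 ≤ H) (m : ℕ) :
    Tendsto (fun Wd : ℕ => rotTopCoeffY H Wd m) atTop (𝓝 (rotTopCoeff H m)) :=
  tendsto_atTop_ciSup (fun _ _ h => rotTopCoeffY_mono_W h m) (bddAbove_rotTopCoeffY hH m)

/-- `β^{→}_{H,W,m} ≤ β^{→}_{H,m}`. [cite: Beaton2014RotatedHoneycomb, Corollary 10 (arXiv v3 p. 15)] -/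
theorem rotTopCoeffY_le_rotTopCoeff (hH : 1 ≤ H) (Wd m : ℕ) : rotTopCoeffY H Wd m ≤ rotTopCoeff H m :=
  le_ciSup (bddAbove_rotTopCoeffY hH m) Wd

/-- `β^{→}_{H,m} ≥ 0`. [cite: Beaton2014RotatedHoneycomb, Corollary 10 (arXiv v3 p. 15)] -/
theorem rotTopCoeff_nonneg (hH : 1 ≤ H) (m : ℕ) : 0 ≤ rotTopCoeff H m :=
  (rotTopCoeffY_nonneg H 0 m).trans (rotTopCoeffY_le_rotTopCoeff hH 0 m)

/-- Every `B^{→}_{H,W+1}(x_c; y)` lies below `Σ_m β^{→}_{H,m} y^m` whenever the latter converges (`y ≥ 0`).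
[cite: Beaton2014RotatedHoneycomb, Corollary 10 (arXiv v3 p. 15)] -/
theorem rotGFy_le_tsum_rotTopCoeff (hH : 1 ≤ H) (hy0 : 0 ≤ y) (hs : Summable fun m => rotTopCoeff H m * y ^ m) (Wd : ℕ) :
    rotGFy ((rotStripV H (Wd + 1)).erase wOut) H (IsRotTopDart H) y ≤ ∑' m, rotTopCoeff H m * y ^ m :=
  hasSum_le (fun m => mul_le_mul_of_nonneg_right (rotTopCoeffY_le_rotTopCoeff hH Wd m) (pow_nonneg hy0 m))
    (hasSum_rotTopCoeffY H Wd y) hs.hasSum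

/-! ### Convergence on the boundedness set, divergence off it -/

/-- **On `rotBddSet H` the series converges, with the value** `sup_W B^{→}_{H,W+1}(x_c; y)` (`H ≥ 1`).
[cite: Beaton2014RotatedHoneycomb, Corollary 10 (arXiv v3 p. 15: radius of convergence y_T); Lemma 12 (p. 17)] -/
theorem hasSum_rotTopCoeff_of_mem (hH : 1 ≤ H) (hy : y ∈ rotBddSet H) :
    HasSum (fun m => rotTopCoeff H m * y ^ m)
      (⨆ Wd : ℕ, rotGFy ((rotStripV H (Wd + 1)).erase wOut) H (IsRotTopDart H) y) := by
  obtain ⟨hy0, hbdd⟩ := hy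
  set S := ⨆ Wd : ℕ, rotGFy ((rotStripV H (Wd + 1)).erase wOut) H (IsRotTopDart H) y with hS
  have hf0 : ∀ m, 0 ≤ rotTopCoeff H m * y ^ m := fun m => mul_nonneg (rotTopCoeff_nonneg hH m) (pow_nonneg hy0 m)
  have hpart : ∀ n, ∑ m ∈ Finset.range n, rotTopCoeff H m * y ^ m ≤ S := by
    intro n
    have hlim : Tendsto (fun Wd : ℕ => ∑ m ∈ Finset.range n, rotTopCoeffY H Wd m * y ^ m) atTop
        (𝓝 (∑ m ∈ Finset.range n, rotTopCoeff H m * y ^ m)) :=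
      tendsto_finsetSum _ fun m _ => (tendsto_rotTopCoeffY hH m).mul_const _
    refine le_of_tendsto' hlim fun Wd => ?_
    calc ∑ m ∈ Finset.range n, rotTopCoeffY H Wd m * y ^ m
          ≤ rotGFy ((rotStripV H (Wd + 1)).erase wOut) H (IsRotTopDart H) y :=
          sum_le_hasSum (Finset.range n) (fun m _ => mul_nonneg (rotTopCoeffY_nonneg H Wd m) (pow_nonneg hy0 m))
            (hasSum_rotTopCoeffY H Wd y)
      _ ≤ S := le_ciSup hbdd Wd
  have hsum : Summable fun m => rotTopCoeff H m * y ^ m := summable_of_sum_range_le hf0 hpart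
  have h1 : ∑' m, rotTopCoeff H m * y ^ m ≤ S := Real.tsum_le_of_sum_range_le hf0 hpart
  have h2 : S ≤ ∑' m, rotTopCoeff H m * y ^ m := ciSup_le fun Wd => rotGFy_le_tsum_rotTopCoeff hH hy0 hsum Wd
  rw [le_antisymm h2 h1]
  exact hsum.hasSum

/-- On the boundedness set the series converges. [cite: Beaton2014RotatedHoneycomb, Corollary 10 (arXiv v3 p. 15)] -/
theorem summable_rotTopCoeff_of_mem (hH : 1 ≤ H) (hy : y ∈ rotBddSet H) : Summable fun m => rotTopCoeff H m * y ^ m :=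
  (hasSum_rotTopCoeff_of_mem hH hy).summable

/-- **Divergence off the boundedness set** (`y ≥ 0`, `H ≥ 1`). [cite: Beaton2014RotatedHoneycomb, Corollary 10 (arXiv v3 p. 15)] -/
theorem not_summable_rotTopCoeff (hH : 1 ≤ H) (hy0 : 0 ≤ y)
    (hnb : ¬ BddAbove (Set.range fun Wd : ℕ => rotGFy ((rotStripV H (Wd + 1)).erase wOut) H (IsRotTopDart H) y)) :
    ¬ Summable fun m => rotTopCoeff H m * y ^ m := fun hs =>
  hnb ⟨∑' m, rotTopCoeff H m * y ^ m, by
    rintro _ ⟨Wd, rfl⟩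
    exact rotGFy_le_tsum_rotTopCoeff hH hy0 hs Wd⟩

/-! ### `y_H` = the radius of convergence -/

/-- **The boundedness set is the convergence set** (`H ≥ 1`): `rotBddSet H = {y ≥ 0 : Σ_m β^{→}_{H,m} y^m converges}`.
[cite: Beaton2014RotatedHoneycomb, Corollary 10 (arXiv v3 p. 15: "have radius of convergence y_T")] -/
theorem rotBddSet_eq_summable (hH : 1 ≤ H) :
    rotBddSet H = {y : ℝ | 0 ≤ y ∧ Summable fun m => rotTopCoeff H m * y ^ m} := by
  ext y
  constructor
  · exact fun hy => ⟨hy.1, summable_rotTopCoeff_of_mem hH hy⟩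
  · rintro ⟨hy0, hs⟩
    by_contra h
    exact not_summable_rotTopCoeff hH hy0 (fun hb => h ⟨hy0, hb⟩) hs

/-- **`y_H` is the radius of convergence of `B^{→}_H(x_c; y) = Σ_m β^{→}_{H,m} y^m`** (on the nonnegative axis; `H ≥ 1`):
`rotYT H = sup {y ≥ 0 : Σ_m β^{→}_{H,m} y^m converges}`. [cite: Beaton2014RotatedHoneycomb, Corollary 10 (arXiv v3 p. 15)] -/
theorem rotYT_eq_sSup_summable (hH : 1 ≤ H) :
    rotYT H = sSup {y : ℝ | 0 ≤ y ∧ Summable fun m => rotTopCoeff H m * y ^ m} := by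
  rw [rotYT, rotBddSet_eq_summable hH]

/-- The boundedness set is an initial segment of `[0, ∞)`. [cite: Beaton2014RotatedHoneycomb, §2.4 (nonnegative coefficients)] -/
theorem mem_rotBddSet_of_le_mem {y y' : ℝ} (hy' : y' ∈ rotBddSet H) (hy0 : 0 ≤ y) (h : y ≤ y') : y ∈ rotBddSet H := by
  obtain ⟨K, hK⟩ := hy'.2
  exact ⟨hy0, ⟨K, by rintro _ ⟨Wd, rfl⟩; exact (rotGFy_mono_y _ H _ hy0 h).trans (hK ⟨Wd, rfl⟩)⟩⟩

/-- Below `y_H` every `y ≥ 0` is in the boundedness set (`H ≥ 2`, where `y_H` is a genuine supremum). [cite: Beaton2014RotatedHoneycomb, Corollary 10 (arXiv v3 p. 15)] -/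
theorem mem_rotBddSet_of_lt_rotYT (hH : 2 ≤ H) (hy0 : 0 ≤ y) (h : y < rotYT H) : y ∈ rotBddSet H := by
  obtain ⟨y', hy', hlt⟩ := exists_lt_of_lt_csSup ⟨1, mem_rotBddSet_of_lt (by omega) one_pos one_lt_rotYdagger⟩ h
  exact mem_rotBddSet_of_le_mem hy' hy0 hlt.le

/-- **Inside the radius** (`H ≥ 2`, `0 ≤ y < y_H`): the series converges, to `sup_W B^{→}_{H,W+1}(x_c; y)`.
[cite: Beaton2014RotatedHoneycomb, Corollary 10 (arXiv v3 p. 15)] -/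
theorem hasSum_rotTopCoeff_of_lt_rotYT (hH : 2 ≤ H) (hy0 : 0 ≤ y) (h : y < rotYT H) :
    HasSum (fun m => rotTopCoeff H m * y ^ m)
      (⨆ Wd : ℕ, rotGFy ((rotStripV H (Wd + 1)).erase wOut) H (IsRotTopDart H) y) :=
  hasSum_rotTopCoeff_of_mem (by omega) (mem_rotBddSet_of_lt_rotYT hH hy0 h)

/-- Inside the radius the series converges. [cite: Beaton2014RotatedHoneycomb, Corollary 10 (arXiv v3 p. 15)] -/
theorem summable_rotTopCoeff_of_lt_rotYT (hH : 2 ≤ H) (hy0 : 0 ≤ y) (h : y < rotYT H) :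
    Summable fun m => rotTopCoeff H m * y ^ m :=
  (hasSum_rotTopCoeff_of_lt_rotYT hH hy0 h).summable

/-- **Outside the radius** (`H ≥ 2`, `y > y_H`): the series diverges. [cite: Beaton2014RotatedHoneycomb, Corollary 10 (arXiv v3 p. 15)] -/
theorem not_summable_rotTopCoeff_of_rotYT_lt (hH : 2 ≤ H) (h : rotYT H < y) :
    ¬ Summable fun m => rotTopCoeff H m * y ^ m := by
  have hy0 : 0 ≤ y := (rotYdagger_pos.le.trans (rotYdagger_le_rotYT hH)).trans h.le
  refine not_summable_rotTopCoeff (by omega) hy0 fun hb => ?_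
  have := le_csSup (rotBddSet_bddAbove hH) ⟨hy0, hb⟩
  unfold rotYT at h
  linarith

/-- At `y = 1` the series sums to `sup_W B^{⊥,→}_{H,W+1}(x_c)` (the tree's `rotStripBR`). [cite: Beaton2014RotatedHoneycomb, §4 (arXiv v3 p. 17) with Appendix Corollary 15 (p. 19)] -/
theorem hasSum_rotTopCoeff_one (hH : 1 ≤ H) : HasSum (fun m => rotTopCoeff H m) (⨆ Wd : ℕ, rotStripBR H (Wd + 1)) := by
  have h := hasSum_rotTopCoeff_of_mem hH (mem_rotBddSet_of_lt hH one_pos one_lt_rotYdagger)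
  simp only [one_pow, mul_one, rotGFy_one, ← rotStripBR_eq_rotGF] at h
  exact h

end Literature.Probability.RandomPlanarGeometry.SAW.HV
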